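import Summits.ResolutionOfSingularities.ResolutionOfSingularities.Theorems.EquisingularLiftEquisingularLiftBlowupModelQuadricsOfNormalForm
import Literature.AlgebraicGeometry.Motives.QuadraticFormSingularRadical
import Literature.AlgebraicGeometry.Motives.QuadraticFormsSmallRank
import Literature.AlgebraicGeometry.Motives.GeneralNonsingularForms
import HarnessLib

/-!
# Crux `EquisingularLift` (stmt-ResolutionOfSingularities-15660), line `Sketch` (v10c): the DEGREE-2 slice of the open residual
# `stub_blowupModel_ge_five` in EVERY characteristic — UNCONDITIONAL (the normal form `NF` of prime quadrics discharged)

[OURS · leafhand-res-equisingularlift-6 g3, 2026-08-31; cell `pub/decomp-res`] AI-produced, weaker than expert review; NOT a statement of any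
manuscript; nothing here proves resolution of singularities in positive characteristic.  DEF-FREE; `--supports stmt-…-15660`; standard axioms;
ZERO named hypotheses.

lh6 g2 landed `blowupModel_of_range_eq_quadric_of_normalForm` (`…BlowupModelQuadricsOfNormalForm`): every integral quadric hypersurface
`(H, ι)` of `ℙⁿ⁺¹_k` has a regular blow-up model PROVIDED the displayed hypothesis `NF` — the characteristic-free normal form of PRIME quadratic
forms.  This file PROVES `NF` over an algebraically closed field of ANY characteristic and removes the hypothesis:

* ★ `quadric_normalForm` — **normal form of a prime quadratic form over an algebraically closed field, every characteristic** (`NF` verbatim):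
  for a prime quadratic form `F ∈ k[x₀, …, x_{n+1}]` there are mutually inverse invertible linear substitutions `τ, τ'` such that `σ_{τ'} F` is
  EITHER a nonsingular form OR `G(x_{ι 0}, …, x_{ι (m+1)})` for a nonsingular quadratic form `G` in `m + 2 ≥ 3` variables with complementary
  idle variables `x_{e 0}, …, x_{e r}`.  Proof (no `2⁻¹` anywhere): split off the singular radical `S = {F = 0} ∩ ker (hessian F)`
  (✓ `ProjectiveSpaceCells.exists_linearSubst_eq_rename_of_isHomogeneous_two`, `Literature/…/QuadraticFormSingularRadical`: `σ_τ F = rename ι G`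
  with the affine cone of `G` free of singular points `≠ 0`); `G` inherits irreducibility from the prime `F`
  (✓ `irreducible_of_irreducible_rename`), so `G` has `≥ 3` variables (✓ quadratic forms in `≤ 2` variables are reducible over `k̄`,
  `Literature/…/QuadraticFormsSmallRank`); «no singular point `≠ 0`» is `IsNonsingularForm` by Hilbert's Nullstellensatz
  (✓ `SmoothHypersurface.isNonsingularForm_of_forall_exists_eval_pderiv_ne_zero`), transported along `rename` (`pderiv_rename`, `eval_rename`);
* ★★ `blowupModel_of_range_eq_quadric` — **every integral quadric hypersurface has a regular blow-up model, in every characteristic**: for every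
  algebraically closed `k` (any `p`), every `n`, every `(H, ι_H)` of the crux (`ι_H : H ↪ ℙⁿ⁺¹_k` closed immersion, `H` integral) with
  `range ι_H = V₊(F)`, `F` a prime quadratic form, there is `𝔞 ≠ ⊥` on `H` ALL of whose blow-ups are regular — the conclusion of the OPEN residual
  `stub_blowupModel_ge_five` on its whole degree-2 slice, now with NO hypothesis (lh6 g2's theorem applied to ★).

Honest label: the registered stub `stub_blowupModel_ge_five` (all degrees, `n ≥ 5`) stays OPEN; this closes its degree-2 instances only (all `n`, all `p`).

References: [Hartshorne1977, I Ex. 5.12, II Ex. 7.12]; [ElmanKarpenkoMerkurjev2008, §7]; [Fulton2008, §2.6].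
-/

set_option linter.dupNamespace false -- mandated namespace `Summit.<Summit>.<Problem>` of this single-conjunct summit

noncomputable section

open CategoryTheory CategoryTheory.Limits AlgebraicGeometry TopologicalSpace
open MvPolynomial HomogeneousLocalization
open Literature.AlgebraicGeometry.Resolution
open Literature.AlgebraicGeometry.Motives Literature.AlgebraicGeometry.Motives.SmoothHypersurface
open Literature.AlgebraicGeometry.Motives.ProjectiveSpace
open Literature.AlgebraicGeometry.Motives.ProjectiveSpaceCells

universe u

namespace Summit.ResolutionOfSingularities.ResolutionOfSingularities.Cruxes.EquisingularLift.StrataSplit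

section NormalForm

variable {k : Type u} [Field k] [IsAlgClosed k] {n : ℕ}

/-- ★ **Normal form of a prime quadratic form over an algebraically closed field of ANY characteristic** — the hypothesis `NF` of
`blowupModel_of_range_eq_quadric_of_normalForm`, discharged: mutually inverse linear substitutions `τ, τ'` with `σ_{τ'} F` EITHER nonsingular OR
the cone `rename ι G` over a nonsingular quadratic form `G` in `m + 2 ≥ 3` variables, the remaining `r + 1` variables idle.  Split off the singular
radical (Elman–Karpenko–Merkurjev §7), bound the number of variables of the regular part below by primality, and read nonsingularity through the
Nullstellensatz. [cite: ElmanKarpenkoMerkurjev2008, §7; Hartshorne1977, I Ex. 5.12] -/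
theorem quadric_normalForm (F : MvPolynomial (Fin (n + 2)) k)
    (hF : F.IsHomogeneous 2) (hprime : Prime F) :
    ∃ (τ τ' : Fin (n + 2) → MvPolynomial (Fin (n + 2)) k) (_ : ∀ i, (τ i).IsHomogeneous 1)
      (_ : ∀ i, (τ' i).IsHomogeneous 1) (_ : ∀ i, aeval τ (τ' i) = X i) (_ : ∀ i, aeval τ' (τ i) = X i),
      IsNonsingularForm k (aeval τ' F) ∨
        ∃ (m r : ℕ) (ι : Fin (m + 2) → Fin (n + 2)) (e : Fin (r + 1) → Fin (n + 2))
          (G : MvPolynomial (Fin (m + 2)) k), 1 ≤ m ∧ Function.Injective ι ∧ Function.Injective e ∧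
            (∀ l, ι l ∉ Set.range e) ∧ (∀ a, a ∉ Set.range e → a ∈ Set.range ι) ∧
            G.IsHomogeneous 2 ∧ IsNonsingularForm k G ∧ aeval τ' F = rename ι G := by
  classical
  obtain ⟨a, c, hac, τ, τ', G, hτ, hτ', hinv, hinv', hG, hkey, hns⟩ :=
    exists_linearSubst_eq_rename_of_isHomogeneous_two (N := n + 1) hF
  have hιinj : Function.Injective (fun l : Fin a => Fin.cast hac (Fin.castAdd c l)) :=
    (Fin.cast_injective hac).comp (Fin.castAdd_injective _ _)
  -- `σ_τ F` is prime, hence `G` is irreducible, hence `a ≥ 3`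
  have hprime' : Prime (aeval τ F) := by
    have h1 : (aeval τ').comp (aeval τ) = AlgHom.id k _ := MvPolynomial.algHom_ext fun i => by
      simpa using hinv' (X i)
    have h2 : (aeval τ).comp (aeval τ') = AlgHom.id k _ := MvPolynomial.algHom_ext fun i => by
      simpa using hinv (X i)
    exact (MulEquiv.prime_iff (AlgEquiv.ofAlgHom (aeval τ) (aeval τ') h2 h1)).mpr hprime
  have hirrG : Irreducible G := by
    refine irreducible_of_irreducible_rename hιinj ?_
    rw [← hkey]
    exact hprime'.irreducible
  have ha3 : 3 ≤ a := by
    by_contra hlt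
    interval_cases a
    · exact hirrG.ne_zero (eq_zero_of_isHomogeneous_two_fin_zero hG)
    · exact not_irreducible_of_isHomogeneous_two_fin_one hG hirrG
    · exact not_irreducible_of_isHomogeneous_two_fin_two hG hirrG
  refine ⟨τ', τ, hτ', hτ, fun i => hinv' (X i) ▸ by rw [aeval_X], fun i => hinv (X i) ▸ by rw [aeval_X], ?_⟩
  -- the Nullstellensatz form of nonsingularity for a renamed `G`
  have hnsG : ∀ {m : ℕ} (ι : Fin a → Fin (m + 2)), Function.Injective ι →
      (∀ z : Fin (m + 2) → k, z ∘ ι = 0 → eval z (rename ι G) = 0 → (∀ j, eval z (pderiv j (rename ι G)) = 0) → z = 0) →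
      IsNonsingularForm k (rename ι G) := by
    intro m ι hι hz
    refine isNonsingularForm_of_forall_exists_eval_pderiv_ne_zero fun z hz0 hGz => ?_
    by_contra hall
    push Not at hall
    have hzι : z ∘ ι = 0 := hns (z ∘ ι) (by rwa [← eval_rename]) fun j => by
      rw [← eval_rename, ← pderiv_rename hι]; exact hall (ι j)
    exact hz0 (hz z hzι hGz hall)
  rcases Nat.eq_zero_or_pos c with hc | hc
  · -- `c = 0`: `F` itself is nonsingular (`ι` is a bijection)
    left
    subst hc
    rw [hkey]
    refine hnsG _ hιinj fun z hzι _ _ => ?_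
    funext j
    have hj : j = Fin.cast hac (Fin.castAdd 0 ⟨j, by omega⟩) := Fin.ext (by simp)
    rw [hj]
    exact congrFun hzι ⟨j, by omega⟩
  · -- `c ≥ 1`: a cone with vertex `ℙ^{c-1}` over the nonsingular quadric `G` in `a = m + 2 ≥ 3` variables
    right
    obtain ⟨m, rfl⟩ : ∃ m, a = m + 2 := ⟨a - 2, by omega⟩
    obtain ⟨r, rfl⟩ : ∃ r, c = r + 1 := ⟨c - 1, by omega⟩
    refine ⟨m, r, fun l => Fin.cast hac (Fin.castAdd (r + 1) l), fun i => Fin.cast hac (Fin.natAdd (m + 2) i), G,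
      by omega, hιinj, (Fin.cast_injective hac).comp (Fin.natAdd_injective _ _), ?_, ?_, hG, ?_, hkey⟩
    · rintro l ⟨i, hi⟩
      have h := congrArg Fin.val hi
      simp at h
      omega
    · intro j hj
      by_cases hjm : (j : ℕ) < m + 2
      · exact ⟨⟨j, hjm⟩, Fin.ext (by simp)⟩
      · exact absurd ⟨⟨j - (m + 2), by omega⟩, Fin.ext (by simp; omega)⟩ hj
    · -- nonsingularity of `G` itself: rename along the identity
      have h := hnsG (m := m) id Function.injective_id fun z hz _ _ => hz
      simpa using h

end NormalForm

/-- ★★ **Every integral quadric hypersurface has a regular blow-up model, in every characteristic.**  For an algebraically closed field `k` of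
any characteristic, every `n`, and every `(H, ι_H)` of the crux binder (`ι_H : H ↪ ℙⁿ⁺¹_k` a closed immersion, `H` integral) whose image is a
quadric `V₊(F)`, `F` a prime quadratic form, `H` carries a non-zero ideal sheaf all of whose blow-ups are regular — the conclusion of the open
residual `stub_blowupModel_ge_five` on its degree-2 slice, UNCONDITIONALLY (lh6 g2's `blowupModel_of_range_eq_quadric_of_normalForm` with `NF`
supplied by `quadric_normalForm`). [cite: Hartshorne1977, I Ex. 5.12 and II Ex. 7.12] -/
theorem blowupModel_of_range_eq_quadric {k : Type} [Field k] [IsAlgClosed k] {n : ℕ}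
    {H : Scheme.{0}} (ιH : H ⟶ (projectiveSpace (n + 1) k).left) [IsClosedImmersion ιH] [IsIntegral H]
    (F : MvPolynomial (Fin (n + 1 + 1)) k) (hF : F.IsHomogeneous 2) (hprime : Prime F)
    (hrange : letI := MvPolynomial.gradedAlgebra (σ := Fin (n + 1 + 1)) (R := k)
      Set.range ιH = {x : Proj (homogeneousSubmodule (Fin (n + 1 + 1)) k) | F ∈ x.asHomogeneousIdeal}) :
    ∃ 𝔞 : H.IdealSheafData, 𝔞 ≠ ⊥ ∧ ∀ (Z : Scheme.{0}) (π : Z ⟶ H), IsBlowup π 𝔞 → Scheme.IsRegular Z :=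
  blowupModel_of_range_eq_quadric_of_normalForm (fun F hF hp => quadric_normalForm F hF hp) ιH F hF hprime hrange

end Summit.ResolutionOfSingularities.ResolutionOfSingularities.Cruxes.EquisingularLift.StrataSplit

end
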